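import Summits.BirchSwinnertonDyer.BirchSwinnertonDyer.Theorems.PrintCf2DisegniPairTwoDisegniGZPrelims
import Literature.NumberTheory.EllipticCurves.Disegni2017.ChiLineTheoremB
import Literature.NumberTheory.EllipticCurves.Disegni2017.ChiLineRamifiedNotExceptionalProofs
import Literature.NumberTheory.EllipticCurves.CuspFormLFunctionLevelConductorProofs
import Literature.NumberTheory.EllipticCurves.PAdicLFunctionInterpolationHoldsProofs
import Literature.NumberTheory.EllipticCurves.QuadraticTwistTwoLFunctionProofs
import Literature.NumberTheory.EllipticCurves.QuadraticTwistNegOneLFunctionProofs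
import Literature.NumberTheory.QuadraticFields.KroneckerCharacterTwoProofs
import HarnessLib

/-!
# Road (C) `disegni-pair-two` on crux stmt-BirchSwinnertonDyer-20368 — THE ENTRY TICKET PAID:
# the text of the support item `PrintCf2.SplitBadTwoDisegniGZPairOfFacts` (stmt-BirchSwinnertonDyer-27325,
# = Lines v3.2 `stub_disegniGZ_pair_two`) is a THEOREM of the three typed facts + modularity

Cell `bsd-print-cf2` (`run/shared/lean/pub/bsd-print-cf2/`), width seat `bsd-line-cf2-p1-w8` g25.
`--supports stmt-BirchSwinnertonDyer-20368` (helper). THEOREMS ONLY (no `def`, no named fact, no `sorry`);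
every named fact appears as an ANTECEDENT of the statements (`thmB_chi_quadraticBaseChange`,
`exists_isCanonicalCyc`, `isCanonicalCyc_pairing_eq_minusTwist`, `hasEntireLFunction_rat`), exactly as in the
route item. BSD is not proved by any of this; no summit statement is claimed; 20368 is not closed here.

## What is proved (§1–§2 are `PrintCf2DisegniPairTwoDisegniGZPrelims.lean`, imported)

* §1 `sq_u_sqChange_and_r_eq_zero` — for EVERY elliptic `W/ℚ` the completed-square change `sqChange W`
  (`C • W = W^{(1)}`, a `Classical.choose`) has `u² = 1` and `r = 0`: `W` and `W^{(1)}` have the same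
  `c₄, c₆, b₂`, so `u⁻⁴c₄ = c₄`, `u⁻⁶c₆ = c₆` force `u⁴ = 1` or `u⁶ = 1` in `ℚ`, i.e. `u² = 1`, and then
  `u⁻²(b₂ + 12r) = b₂` forces `r = 0` (the tree had this for `cm7` only, by solving the equations:
  `sq_u_sqChange_cm7_and_r`). Hence `x_twistPointEquivOver_incl_some'`: the abscissa of the twist
  substitution `Φ_t(ι(X, Y))` (`twistPointEquivOver`, `(X,Y) ↦ (X/t², Y/t³)` then un-completing the square)
  is `t⁻²·X` for every `V`.
* §2 `simpleZero_rankinSelberg_of_pair` — (ε): EVERY entire continuation `Λ` of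
  `rankinSelbergEulerProductHecke f (ψ∘N_{K/ℚ})` from `re s > 2` has `Λ(1) = 0 ≠ Λ′(1)`, when `f` is the
  newform of `V`, `W = V ⊗ ψ` has analytic rank `1` and `W′ = V ⊗ ψκ_K` has `L(W′,1) ≠ 0`: Artin formalism
  (tree THEOREM `rankinSelbergEulerProductHecke_baseChangeDirichlet_eq_holds`) + modularity continuation
  (`entireLFunction_eq_twistedLSeries`) say `L(W,·)·L(W′,·)` is such a continuation; identity theorem;
  `L(W,1) = 0`, `L′(W,1) ≠ 0` (`entireLFunction_one_eq_zero_of_analyticRank_eq_one`,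
  `leadingLCoeff_eq_deriv_of_analyticRank_eq_one`).
* §3 `disegniGZ_line_of_prints` — ONE line of the item for a primitive `ψ` mod `m ∣ 8`, `2 ∣ m`, with
  `ψ(ℓ) = (d/ℓ)` at odd primes and twist parameter `e = d`: the three facts COMPOSED by ty2's
  `thmB_chi_quadraticBaseChange.exists_datum_pinned_of_fixing` (p800140), whose remaining hypotheses are
  DISCHARGED here: `ℓ ∣ m ⇒ ℓ² ∤ N` at an ARBITRARY level `N` of the newform of `V`
  (`IsNewformOf.dvd_level_iff_dvd_conductorNorm`, PROVED — no Carayol — + `V` good at `2`); not exceptional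
  (`isNotExceptionalAt_compRelNorm_ofDirichlet_of_split`, `unitRoot_coe_spec`); (ε) by §2, which needs the
  value `κ(2)` that the item does NOT hand over — derived from the odd-prime values
  (`kroneckerChar_two_of_ncard_primesOver_two`: `2` split ⇒ `d_K ≡ 1 (8)` ⇒ `κ(2) = 1`); `χ(τ) = −1` from the
  sign function `s`; the PIN at every `P ∈ V^{(e)}(ℚ)` by §1 (`x = X/e`) and `map_zero` at `P = O`.
* §4 ★★★ `disegniGZ_pair_two_of_prints` — the CONJUNCTION for `(χ₈, 2)`, `(χ₄, −1)`, `(χ₈′, −2)`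
  (Mathlib `jacobiSym.at_two / at_neg_one / at_neg_two`, tree `isPrimitive_χ₈/χ₄/χ₈'_ringHomComp`): its
  TYPE is the text of stmt-BirchSwinnertonDyer-27325 verbatim (pen g25
  `bsd-print-cf2-plan/v3/stub_disegniGZ_pair_two_v31_TWIN.txt`, sha16 f03717c5c32d7874), so the route
  item closes by `:= disegniGZ_pair_two_of_prints` and the Lines stub by the same term.

References: D. Disegni, Compos. Math. 153 (2017), Thm. B, (1.1.3), (4.1.7) [Disegni2017]; B. Gross, MSRI
Publ. 49 (2004) §3, §13 [Gross2004]; C. Breuil, B. Conrad, F. Diamond, R. Taylor, JAMS 14 (2001) Thm. A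
[BreuilConradDiamondTaylor2001]; J. Silverman, AEC (2009) III.1, X.5 Cor. 5.4 [SilvermanAEC2009]; F. Diamond,
J. Shurman (2005) Prop. 5.8.5, (8.44) [DiamondShurman2005]; D. Cox (2013) Lemma 1.14 [Cox2013];
B. Mazur, W. Stein, J. Tate (2006) §2.7–2.8 [MazurSteinTate2006].
-/

set_option autoImplicit false
set_option linter.dupNamespace false

noncomputable section

open scoped Classical MatrixGroups ModularForm NumberField

open CongruenceSubgroup NumberField IsDedekindDomain WeierstrassCurve Literature.NumberTheory.EllipticCurves
  Literature.NumberTheory.EllipticCurves.ModularForms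
  Literature.NumberTheory.EllipticCurves.Disegni2017 Literature.NumberTheory.GaloisRepresentations
  Summit.BirchSwinnertonDyer.Rank1Residual.AdditivePotMult

namespace Summit.BirchSwinnertonDyer.BirchSwinnertonDyer.Theorems.PrintCf2.DisegniPairTwo

/-! ### §3 ONE line of the item, for a primitive `ψ` mod `m ∣ 8` with `ψ(ℓ) = (d/ℓ)` at odd primes -/

section Line

/-- **One `ψ∘N`-line of `PrintCf2.SplitBadTwoDisegniGZPairOfFacts` from the three typed facts +
modularity.** For `ψ` a primitive Dirichlet character mod `m` with `m ∣ 8`, `2 ∣ m` and `ψ(ℓ) = (d/ℓ)` at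
every odd prime `ℓ` (`ψ = χ₈, χ₄, χ₈′` for `d = 2, −1, −2`), and twist parameter `e = d ∈ ℚ`: there is a
universal `ρ ∈ ℤ` (`= v₂(c)`, `c` the constant of `thmB_chi_quadraticBaseChange`) such that for every frame
of the item — `K` imaginary quadratic with `2` split, `𝔭 ≠ 𝔭′ ∋ 2`, a Kronecker character `κ` given by
its ODD-prime values only, `V` good ordinary at `2` with newform `f` (any level), the member `W = V ⊗ ψ` of
analytic rank `1`, the companion `W′` with `L(W′,1) ≠ 0`, `H = K(t)`, `t² = e`, `V ⊗ H` globally minimal,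
`G ≤ Aut(H/ℚ)` fixing `K`, `τ ∈ G` with `τ|_K = id`, `τt = −t`, `χ = s` with `s(τ) = −1` — there is a
`G`-invariant datum `DH` on `V(H)` with `ChiLineGrossZagierClauses … (ψ∘N) … DH` and PINNED to every
canonical minus-twist `ℚ`-datum `Dc` of `V^{(e)}` by `DH(Φ_t P, Φ_t P) = r·Dc(P, P)`, `r ≠ 0`,
`v₂(r) = ρ`. Discharges: `hψ` (given), `ℓ ∣ m ⇒ ℓ² ∤ N` (`IsNewformOf.dvd_level_iff_dvd_conductorNorm` + good
reduction at `2`), not exceptional (`isNotExceptionalAt_compRelNorm_ofDirichlet_of_split`), (ε)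
(`simpleZero_rankinSelberg_of_pair`, with `κ(2)` from `kroneckerChar_two_of_ncard_primesOver_two`),
`χ(τ) = −1`, the PIN (`x_twistPointEquivOver_incl_some'`).
[cite: Disegni2017, Theorem B (arXiv v3 PDF p. 8 L9–18), (4.1.7)] [cite: MazurSteinTate2006, §2.7–2.8]
[cite: Gross2004, §13] -/
theorem disegniGZ_line_of_prints (hB : thmB_chi_quadraticBaseChange) (hE : exists_isCanonicalCyc)
    (hPin : isCanonicalCyc_pairing_eq_minusTwist) (hmod : hasEntireLFunction_rat)
    {m : ℕ} [NeZero m] (ξ : DirichletCharacter ℂ m) (hξ : ξ.IsPrimitive) (hm8 : m ∣ 8) (hm2 : 2 ∣ m)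
    (d : ℤ) (e : ℚ) (he : (d : ℚ) = e)
    (hξd : ∀ ℓ : ℕ, ℓ.Prime → ℓ ≠ 2 → ξ ℓ = (jacobiSym d ℓ : ℂ)) :
    ∃ ρ : ℤ, ∀ (ι : PadicAlgCl 2 ≃+* ℂ) (K : Type) [Field K] [NumberField K] [IsGalois ℚ K],
    Literature.NumberTheory.EllipticCurves.IsImaginaryQuadratic K → ((Ideal.span {(2 : ℤ)}).primesOver
    (NumberField.RingOfIntegers K)).ncard = 2 → ∀ (𝔭 𝔭' : IsDedekindDomain.HeightOneSpectrum
    (NumberField.RingOfIntegers K)), ((2 : ℕ) : NumberField.RingOfIntegers K) ∈ 𝔭.asIdeal → ((2 : ℕ) :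
    NumberField.RingOfIntegers K) ∈ 𝔭'.asIdeal → 𝔭 ≠ 𝔭' → ∀ (κ : DirichletCharacter ℂ (NumberField.discr
    K).natAbs), (∀ ℓ : ℕ, ℓ.Prime → ℓ ≠ 2 → κ ℓ = (jacobiSym (NumberField.discr K) ℓ : ℂ)) → ∀ (V V' :
    WeierstrassCurve ℚ) [V.IsElliptic] [V.IsGloballyMinimal] [V'.IsElliptic] [V'.IsGloballyMinimal],
    Literature.NumberTheory.EllipticCurves.IsOrdinaryAt V 2 → ∀ {N N' : ℕ} [NeZero N] [NeZero N'] (f : CuspForm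
    (CongruenceSubgroup.Gamma0 N) 2) (f' : CuspForm (CongruenceSubgroup.Gamma0 N') 2),
    Literature.NumberTheory.EllipticCurves.ModularForms.IsNewformOf V f →
    Literature.NumberTheory.EllipticCurves.ModularForms.IsNewformOf V' f' → (∀ n : ℕ,
    Literature.NumberTheory.EllipticCurves.ModularForms.cuspCoeff f' n = κ (n : ZMod _) *
    Literature.NumberTheory.EllipticCurves.ModularForms.cuspCoeff f n) → ∀ {M M' : ℕ} [NeZero M] [NeZero M'] (g
    : CuspForm (CongruenceSubgroup.Gamma0 M) 2) (g' : CuspForm (CongruenceSubgroup.Gamma0 M') 2) (W W' :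
    WeierstrassCurve ℚ) [W.IsElliptic] [W'.IsElliptic],
    Literature.NumberTheory.EllipticCurves.ModularForms.IsNewformOf W g →
    Literature.NumberTheory.EllipticCurves.ModularForms.IsNewformOf W' g' → (∀ m : ℕ,
    Literature.NumberTheory.EllipticCurves.ModularForms.cuspCoeff g m = (ξ) m *
    Literature.NumberTheory.EllipticCurves.ModularForms.cuspCoeff f m) → (∀ m : ℕ,
    Literature.NumberTheory.EllipticCurves.ModularForms.cuspCoeff g' m = (ξ) m *
    Literature.NumberTheory.EllipticCurves.ModularForms.cuspCoeff f' m) → W.analyticRank = 1 →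
    W'.entireLFunction 1 ≠ 0 → ∀ {H : Type} [Field H] [NumberField H] [Algebra K H] [(V.baseChange
    H).IsGloballyMinimal], Module.finrank K H = 2 → ∀ {t : H} (htK : t ∉ Set.range (algebraMap K H)) (ht2 : t ^
    2 = algebraMap ℚ H e) (htQ : t ∉ Set.range (algebraMap ℚ H)) (G : Subgroup (H ≃ₐ[ℚ] H)) (χ : G →* ℂˣ) (s : G
    → ℤ), (∀ σ, ((χ σ : ℂˣ) : ℂ) = (s σ : ℂ)) → (∀ (σ : G) (a : K), σ.1 (algebraMap K H a) = algebraMap K H a) →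
    ∀ (τ : H ≃ₐ[ℚ] H) (hτG : τ ∈ G), s ⟨τ, hτG⟩ = -1 → (∀ a : K, τ (algebraMap K H a) = algebraMap K H a) → τ t
    = -t → ∀ [(V.quadraticTwist e).IsElliptic], ∃ DH : WeierstrassCurve.PAdicHeightDataK V 2 H, (∀ (σ : G) (a b
    : (V.baseChange H).toAffine.Point), DH.pairing (Literature.NumberTheory.EllipticCurves.pointGalHom V H σ.1
    a) (Literature.NumberTheory.EllipticCurves.pointGalHom V H σ.1 b) = DH.pairing a b) ∧
    Literature.NumberTheory.EllipticCurves.Disegni2017.ChiLineGrossZagierClauses ι K V H f (ι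
    (((Literature.NumberTheory.EllipticCurves.unitRoot V 2 : ℚ_[2]) : PadicAlgCl 2)))
    (Literature.NumberTheory.EllipticCurves.Disegni2017.baseChangeDirichlet K (ξ)) 𝔭 𝔭' G χ DH ∧ ∃ r : ℚ, r ≠ 0
    ∧ padicValRat 2 r = ρ ∧ ∀ (Dc : WeierstrassCurve.PAdicHeightData (V.quadraticTwist e) 2),
    Dc.IsCanonicalSqMinusTwist → ∀ P : (V.quadraticTwist e).toAffine.Point, DH.pairing
    (Summit.BirchSwinnertonDyer.Rank1Residual.AdditivePotMult.twistPointEquivOver V (htQ) ht2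
    (WeierstrassCurve.QuadraticDescent.incl H (V.quadraticTwist e) P))
    (Summit.BirchSwinnertonDyer.Rank1Residual.AdditivePotMult.twistPointEquivOver V (htQ) ht2
    (WeierstrassCurve.QuadraticDescent.incl H (V.quadraticTwist e) P)) = (r : ℚ_[2]) * Dc.pairing P P := by
  subst he
  obtain ⟨c, hc, h⟩ := thmB_chi_quadraticBaseChange.exists_datum_pinned_of_fixing hB hE hPin (p := 2)
  refine ⟨padicValRat 2 c, ?_⟩
  intro ι K _ _ _ hK hsplit 𝔭 𝔭' h𝔭 h𝔭' hne κ hκ V V' _ _ _ _ hordV N N' _ _ f f' hfV _hfV' hV' M M' _ _ g g'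
    W W' _ _ hg hg' hgξ hg'ξ hW1 hL' H _ _ _ _ hKH t htK ht2 htQ G χ s hs hGK τ hτG hsτ hτK hτt _
  -- the quadratic field: `[K:ℚ] = 2`, `d_K ≡ 1 (8)`, `κ(2) = 1`, `(m, d_K) = 1`
  have h2K : Module.finrank ℚ K = 2 := hK.1
  have h81 : NumberField.discr K % 8 = 1 :=
    (Literature.NumberTheory.QuadraticFields.Quadratic.ncard_primesOver_two_eq_two_iff (K := K) h2K).mp
      hsplit
  obtain ⟨-, hκ2⟩ :=
    Literature.NumberTheory.QuadraticFields.kroneckerChar_two_of_ncard_primesOver_two h2K hsplit κ hκ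
  have hd2 : Nat.Coprime 2 (NumberField.discr K).natAbs := by
    rw [Nat.coprime_two_left, Int.natAbs_odd]
    exact Int.odd_iff.mpr (by omega)
  have hcop : Nat.Coprime m (NumberField.discr K).natAbs :=
    Nat.Coprime.coprime_dvd_left hm8 (by simpa using Nat.Coprime.pow_left 3 hd2)
  -- the fact's hypotheses on `ψ` and on the level
  have hψ : ∀ ℓ : ℕ, ℓ.Prime → ℓ ≠ 2 → ¬ ℓ ∣ m → ξ ℓ = (jacobiSym d ℓ : ℂ) :=
    fun ℓ hℓ hℓ2 _ => hξd ℓ hℓ hℓ2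
  have hmN : ∀ ℓ : ℕ, ℓ.Prime → ℓ ∣ m → ¬ ℓ ^ 2 ∣ N := by
    intro ℓ hℓ hℓm hℓN
    have hℓ8 : ℓ ∣ 2 ^ 3 := by simpa using dvd_trans hℓm hm8
    have hℓ2 : ℓ = 2 := (Nat.prime_dvd_prime_iff_eq hℓ Nat.prime_two).mp (hℓ.dvd_of_dvd_pow hℓ8)
    subst hℓ2
    have h2N : 2 ∣ N := dvd_trans (dvd_pow_self 2 two_ne_zero) hℓN
    have hbad := (hfV.dvd_level_iff_dvd_conductorNorm Nat.prime_two).mp h2N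
    exact (V.dvd_conductorNorm_iff_not_hasGoodReductionAtPrime 2).mp hbad hordV.1
  -- not exceptional at `𝔭`, `𝔭′` (`ψ∘N` ramified above `2`, `a ≠ 0`)
  have hα0 : (unitRoot V 2 : ℚ_[2]) ≠ 0 := (unitRoot_coe_spec (W := V) hordV).2.2
  have ha : ι (((unitRoot V 2 : ℚ_[2]) : PadicAlgCl 2)) ≠ 0 :=
    (map_ne_zero ι).mpr ((map_ne_zero (algebraMap ℚ_[2] (PadicAlgCl 2))).mpr hα0)
  have hexc : IsNotExceptionalAt (p := 2) (ι (((unitRoot V 2 : ℚ_[2]) : PadicAlgCl 2)))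
      (baseChangeDirichlet K ξ) 𝔭 := by
    rw [baseChangeDirichlet_def]
    exact isNotExceptionalAt_compRelNorm_ofDirichlet_of_split (p := 2) h2K hsplit hξ hm2 𝔭 h𝔭 ha
  have hexc' : IsNotExceptionalAt (p := 2) (ι (((unitRoot V 2 : ℚ_[2]) : PadicAlgCl 2)))
      (baseChangeDirichlet K ξ) 𝔭' := by
    rw [baseChangeDirichlet_def]
    exact isNotExceptionalAt_compRelNorm_ofDirichlet_of_split (p := 2) h2K hsplit hξ hm2 𝔭' h𝔭' ha
  -- (ε): simple central zero
  have hΛ := simpleZero_rankinSelberg_of_pair K hmod h2K κ hκ hκ2 hfV.1 hV' hξ hcop W W' hg hg' hgξ hg'ξ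
    hW1 hL'
  -- `χ(τ) = s(τ) = −1`
  have hχ : ((χ ⟨τ, hτG⟩ : ℂˣ) : ℂ) = -1 := by
    rw [hs, hsτ]
    norm_num
  obtain ⟨DH, hinv, hGZ, hpin⟩ := h ι K 𝔭 𝔭' V f ξ d H t τ G χ hτG hK hsplit h𝔭 h𝔭' hne hfV hordV hψ hmN
    hexc hexc' hΛ hKH ht2 htK hτK hτt hGK hχ
  refine ⟨DH, fun σ a b => hinv σ.1 a b, hGZ, c, hc, rfl, fun Dc hDc P => ?_⟩
  rcases P with _ | ⟨X, Y, hP⟩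
  · rw [← Affine.Point.zero_def]
    simp only [map_zero, mul_zero]
  · obtain ⟨yQ, hQ, hQeq⟩ := x_twistPointEquivOver_incl_some' V htQ ht2 hP
    rw [hQeq]
    refine hpin Dc hDc hP hQ ?_
    rw [inv_pow, ht2, ← map_inv₀, ← map_mul, ← div_eq_inv_mul]

end Line

/-! ### §4 ★★★ The item text: the three lines `(χ₈, 2)`, `(χ₄, −1)`, `(χ₈′, −2)` -/

section Pair

/-- `χ₈(ℓ) = (2/ℓ)` at odd primes (Mathlib `jacobiSym.at_two`), in the cast form of the item.
[cite: IrelandRosen1990, Prop. 5.2.2] -/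
theorem χ₈_ringHomComp_eq_jacobiSym (ℓ : ℕ) (hℓ : ℓ.Prime) (hℓ2 : ℓ ≠ 2) :
    (ZMod.χ₈.ringHomComp (Int.castRingHom ℂ)) ℓ = (jacobiSym 2 ℓ : ℂ) := by
  rw [MulChar.ringHomComp_apply, jacobiSym.at_two (hℓ.odd_of_ne_two hℓ2)]
  rfl

/-- `χ₄(ℓ) = (−1/ℓ)` at odd primes (Mathlib `jacobiSym.at_neg_one`), in the cast form of the item.
[cite: IrelandRosen1990, Prop. 5.2.2] -/
theorem χ₄_ringHomComp_eq_jacobiSym (ℓ : ℕ) (hℓ : ℓ.Prime) (hℓ2 : ℓ ≠ 2) :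
    (ZMod.χ₄.ringHomComp (Int.castRingHom ℂ)) ℓ = (jacobiSym (-1) ℓ : ℂ) := by
  rw [MulChar.ringHomComp_apply, jacobiSym.at_neg_one (hℓ.odd_of_ne_two hℓ2)]
  rfl

/-- `χ₈′(ℓ) = (−2/ℓ)` at odd primes (Mathlib `jacobiSym.at_neg_two`), in the cast form of the item.
[cite: IrelandRosen1990, Prop. 5.2.2] -/
theorem χ₈'_ringHomComp_eq_jacobiSym (ℓ : ℕ) (hℓ : ℓ.Prime) (hℓ2 : ℓ ≠ 2) :
    (ZMod.χ₈'.ringHomComp (Int.castRingHom ℂ)) ℓ = (jacobiSym (-2) ℓ : ℂ) := by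
  rw [MulChar.ringHomComp_apply, jacobiSym.at_neg_two (hℓ.odd_of_ne_two hℓ2)]
  rfl

/-- ★★★ **THE ENTRY TICKET PAID — the text of the route item `PrintCf2.SplitBadTwoDisegniGZPairOfFacts`
(stmt-BirchSwinnertonDyer-27325; = Lines v3.2 `stub_disegniGZ_pair_two`) is a THEOREM**: the print-conjoined
Disegni–Gross–Zagier pair (Thm A ∧ Thm B ÷ YZZ (1.1.3) clauses for a `G`-invariant `H`-datum, pinned to the
canonical minus-twist height up to a universal unit class `ρ` per line) on the three `ε_{d*}∘N`-lines
`d* ∈ {2, −1, −2}` of the split-bad CM rank-one class at `2`, from the typed facts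
`thmB_chi_quadraticBaseChange`, `exists_isCanonicalCyc`, `isCanonicalCyc_pairing_eq_minusTwist` (ty2 g50)
and the modularity continuation `hasEntireLFunction_rat`, by `disegniGZ_line_of_prints` at
`(χ₈, 8, 2)`, `(χ₄, 4, −1)`, `(χ₈′, 8, −2)`. The TYPE below is the served signature of
stmt-BirchSwinnertonDyer-27325 verbatim (HOME `bsd-print-cf2-plan/v3/stub_disegniGZ_pair_two_v31_TWIN.txt`,
sha16 f03717c5c32d7874). [cite: Disegni2017, Theorem A, Theorem B (arXiv v3 PDF pp. 6–8), (1.1.3), (4.1.7)]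
[cite: MazurSteinTate2006, §2.7–2.8] [cite: Gross2004, §3, §13] [cite: BreuilConradDiamondTaylor2001, Thm. A] -/
theorem disegniGZ_pair_two_of_prints :
    Literature.NumberTheory.EllipticCurves.Disegni2017.thmB_chi_quadraticBaseChange → WeierstrassCurve.exists_isCanonicalCyc → WeierstrassCurve.isCanonicalCyc_pairing_eq_minusTwist → WeierstrassCurve.hasEntireLFunction_rat → ( (∃ ρ : ℤ, ∀ (ι : PadicAlgCl 2 ≃+* ℂ) (K : Type) [Field K] [NumberField K] [IsGalois ℚ K],
    Literature.NumberTheory.EllipticCurves.IsImaginaryQuadratic K → ((Ideal.span {(2 : ℤ)}).primesOver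
    (NumberField.RingOfIntegers K)).ncard = 2 → ∀ (𝔭 𝔭' : IsDedekindDomain.HeightOneSpectrum
    (NumberField.RingOfIntegers K)), ((2 : ℕ) : NumberField.RingOfIntegers K) ∈ 𝔭.asIdeal → ((2 : ℕ) :
    NumberField.RingOfIntegers K) ∈ 𝔭'.asIdeal → 𝔭 ≠ 𝔭' → ∀ (κ : DirichletCharacter ℂ (NumberField.discr
    K).natAbs), (∀ ℓ : ℕ, ℓ.Prime → ℓ ≠ 2 → κ ℓ = (jacobiSym (NumberField.discr K) ℓ : ℂ)) → ∀ (V V' :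
    WeierstrassCurve ℚ) [V.IsElliptic] [V.IsGloballyMinimal] [V'.IsElliptic] [V'.IsGloballyMinimal],
    Literature.NumberTheory.EllipticCurves.IsOrdinaryAt V 2 → ∀ {N N' : ℕ} [NeZero N] [NeZero N'] (f :
    CuspForm (CongruenceSubgroup.Gamma0 N) 2) (f' : CuspForm (CongruenceSubgroup.Gamma0 N') 2),
    Literature.NumberTheory.EllipticCurves.ModularForms.IsNewformOf V f →
    Literature.NumberTheory.EllipticCurves.ModularForms.IsNewformOf V' f' → (∀ n : ℕ,
    Literature.NumberTheory.EllipticCurves.ModularForms.cuspCoeff f' n = κ (n : ZMod _) *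
    Literature.NumberTheory.EllipticCurves.ModularForms.cuspCoeff f n) → ∀ {M M' : ℕ} [NeZero M] [NeZero
    M'] (g : CuspForm (CongruenceSubgroup.Gamma0 M) 2) (g' : CuspForm (CongruenceSubgroup.Gamma0 M') 2) (W
    W' : WeierstrassCurve ℚ) [W.IsElliptic] [W'.IsElliptic],
    Literature.NumberTheory.EllipticCurves.ModularForms.IsNewformOf W g →
    Literature.NumberTheory.EllipticCurves.ModularForms.IsNewformOf W' g' → (∀ m : ℕ,
    Literature.NumberTheory.EllipticCurves.ModularForms.cuspCoeff g m = (ZMod.χ₈.ringHomComp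
    (Int.castRingHom ℂ)) m * Literature.NumberTheory.EllipticCurves.ModularForms.cuspCoeff f m) → (∀ m :
    ℕ, Literature.NumberTheory.EllipticCurves.ModularForms.cuspCoeff g' m = (ZMod.χ₈.ringHomComp
    (Int.castRingHom ℂ)) m * Literature.NumberTheory.EllipticCurves.ModularForms.cuspCoeff f' m) →
    W.analyticRank = 1 → W'.entireLFunction 1 ≠ 0 → ∀ {H : Type} [Field H] [NumberField H] [Algebra K H]
    [(V.baseChange H).IsGloballyMinimal], Module.finrank K H = 2 → ∀ {t : H} (htK : t ∉ Set.range
    (algebraMap K H)) (ht2 : t ^ 2 = algebraMap ℚ H 2) (htQ : t ∉ Set.range (algebraMap ℚ H)) (G :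
    Subgroup (H ≃ₐ[ℚ] H)) (χ : G →* ℂˣ) (s : G → ℤ), (∀ σ, ((χ σ : ℂˣ) : ℂ) = (s σ : ℂ)) → (∀ (σ : G) (a :
    K), σ.1 (algebraMap K H a) = algebraMap K H a) → ∀ (τ : H ≃ₐ[ℚ] H) (hτG : τ ∈ G), s ⟨τ, hτG⟩ = -1 → (∀
    a : K, τ (algebraMap K H a) = algebraMap K H a) → τ t = -t → ∀ [(V.quadraticTwist 2).IsElliptic], ∃ DH
    : WeierstrassCurve.PAdicHeightDataK V 2 H, (∀ (σ : G) (a b : (V.baseChange H).toAffine.Point),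
    DH.pairing (Literature.NumberTheory.EllipticCurves.pointGalHom V H σ.1 a)
    (Literature.NumberTheory.EllipticCurves.pointGalHom V H σ.1 b) = DH.pairing a b) ∧
    Literature.NumberTheory.EllipticCurves.Disegni2017.ChiLineGrossZagierClauses ι K V H f (ι
    (((Literature.NumberTheory.EllipticCurves.unitRoot V 2 : ℚ_[2]) : PadicAlgCl 2)))
    (Literature.NumberTheory.EllipticCurves.Disegni2017.baseChangeDirichlet K (ZMod.χ₈.ringHomComp
    (Int.castRingHom ℂ))) 𝔭 𝔭' G χ DH ∧ ∃ r : ℚ, r ≠ 0 ∧ padicValRat 2 r = ρ ∧ ∀ (Dc :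
    WeierstrassCurve.PAdicHeightData (V.quadraticTwist 2) 2), Dc.IsCanonicalSqMinusTwist → ∀ P :
    (V.quadraticTwist 2).toAffine.Point, DH.pairing
    (Summit.BirchSwinnertonDyer.Rank1Residual.AdditivePotMult.twistPointEquivOver V (htQ) ht2
    (WeierstrassCurve.QuadraticDescent.incl H (V.quadraticTwist 2) P))
    (Summit.BirchSwinnertonDyer.Rank1Residual.AdditivePotMult.twistPointEquivOver V (htQ) ht2
    (WeierstrassCurve.QuadraticDescent.incl H (V.quadraticTwist 2) P)) = (r : ℚ_[2]) * Dc.pairing P P) ∧ (∃ ρ : ℤ, ∀ (ι : PadicAlgCl 2 ≃+* ℂ) (K : Type) [Field K] [NumberField K] [IsGalois ℚ K],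
    Literature.NumberTheory.EllipticCurves.IsImaginaryQuadratic K → ((Ideal.span {(2 : ℤ)}).primesOver
    (NumberField.RingOfIntegers K)).ncard = 2 → ∀ (𝔭 𝔭' : IsDedekindDomain.HeightOneSpectrum
    (NumberField.RingOfIntegers K)), ((2 : ℕ) : NumberField.RingOfIntegers K) ∈ 𝔭.asIdeal → ((2 : ℕ) :
    NumberField.RingOfIntegers K) ∈ 𝔭'.asIdeal → 𝔭 ≠ 𝔭' → ∀ (κ : DirichletCharacter ℂ (NumberField.discr
    K).natAbs), (∀ ℓ : ℕ, ℓ.Prime → ℓ ≠ 2 → κ ℓ = (jacobiSym (NumberField.discr K) ℓ : ℂ)) → ∀ (V V' :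
    WeierstrassCurve ℚ) [V.IsElliptic] [V.IsGloballyMinimal] [V'.IsElliptic] [V'.IsGloballyMinimal],
    Literature.NumberTheory.EllipticCurves.IsOrdinaryAt V 2 → ∀ {N N' : ℕ} [NeZero N] [NeZero N'] (f :
    CuspForm (CongruenceSubgroup.Gamma0 N) 2) (f' : CuspForm (CongruenceSubgroup.Gamma0 N') 2),
    Literature.NumberTheory.EllipticCurves.ModularForms.IsNewformOf V f →
    Literature.NumberTheory.EllipticCurves.ModularForms.IsNewformOf V' f' → (∀ n : ℕ,
    Literature.NumberTheory.EllipticCurves.ModularForms.cuspCoeff f' n = κ (n : ZMod _) *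
    Literature.NumberTheory.EllipticCurves.ModularForms.cuspCoeff f n) → ∀ {M M' : ℕ} [NeZero M] [NeZero
    M'] (g : CuspForm (CongruenceSubgroup.Gamma0 M) 2) (g' : CuspForm (CongruenceSubgroup.Gamma0 M') 2) (W
    W' : WeierstrassCurve ℚ) [W.IsElliptic] [W'.IsElliptic],
    Literature.NumberTheory.EllipticCurves.ModularForms.IsNewformOf W g →
    Literature.NumberTheory.EllipticCurves.ModularForms.IsNewformOf W' g' → (∀ m : ℕ,
    Literature.NumberTheory.EllipticCurves.ModularForms.cuspCoeff g m = (ZMod.χ₄.ringHomComp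
    (Int.castRingHom ℂ)) m * Literature.NumberTheory.EllipticCurves.ModularForms.cuspCoeff f m) → (∀ m :
    ℕ, Literature.NumberTheory.EllipticCurves.ModularForms.cuspCoeff g' m = (ZMod.χ₄.ringHomComp
    (Int.castRingHom ℂ)) m * Literature.NumberTheory.EllipticCurves.ModularForms.cuspCoeff f' m) →
    W.analyticRank = 1 → W'.entireLFunction 1 ≠ 0 → ∀ {H : Type} [Field H] [NumberField H] [Algebra K H]
    [(V.baseChange H).IsGloballyMinimal], Module.finrank K H = 2 → ∀ {t : H} (htK : t ∉ Set.range
    (algebraMap K H)) (ht2 : t ^ 2 = algebraMap ℚ H (-1)) (htQ : t ∉ Set.range (algebraMap ℚ H)) (G :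
    Subgroup (H ≃ₐ[ℚ] H)) (χ : G →* ℂˣ) (s : G → ℤ), (∀ σ, ((χ σ : ℂˣ) : ℂ) = (s σ : ℂ)) → (∀ (σ : G) (a :
    K), σ.1 (algebraMap K H a) = algebraMap K H a) → ∀ (τ : H ≃ₐ[ℚ] H) (hτG : τ ∈ G), s ⟨τ, hτG⟩ = -1 → (∀
    a : K, τ (algebraMap K H a) = algebraMap K H a) → τ t = -t → ∀ [(V.quadraticTwist (-1)).IsElliptic], ∃
    DH : WeierstrassCurve.PAdicHeightDataK V 2 H, (∀ (σ : G) (a b : (V.baseChange H).toAffine.Point),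
    DH.pairing (Literature.NumberTheory.EllipticCurves.pointGalHom V H σ.1 a)
    (Literature.NumberTheory.EllipticCurves.pointGalHom V H σ.1 b) = DH.pairing a b) ∧
    Literature.NumberTheory.EllipticCurves.Disegni2017.ChiLineGrossZagierClauses ι K V H f (ι
    (((Literature.NumberTheory.EllipticCurves.unitRoot V 2 : ℚ_[2]) : PadicAlgCl 2)))
    (Literature.NumberTheory.EllipticCurves.Disegni2017.baseChangeDirichlet K (ZMod.χ₄.ringHomComp
    (Int.castRingHom ℂ))) 𝔭 𝔭' G χ DH ∧ ∃ r : ℚ, r ≠ 0 ∧ padicValRat 2 r = ρ ∧ ∀ (Dc :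
    WeierstrassCurve.PAdicHeightData (V.quadraticTwist (-1)) 2), Dc.IsCanonicalSqMinusTwist → ∀ P :
    (V.quadraticTwist (-1)).toAffine.Point, DH.pairing
    (Summit.BirchSwinnertonDyer.Rank1Residual.AdditivePotMult.twistPointEquivOver V (htQ) ht2
    (WeierstrassCurve.QuadraticDescent.incl H (V.quadraticTwist (-1)) P))
    (Summit.BirchSwinnertonDyer.Rank1Residual.AdditivePotMult.twistPointEquivOver V (htQ) ht2
    (WeierstrassCurve.QuadraticDescent.incl H (V.quadraticTwist (-1)) P)) = (r : ℚ_[2]) * Dc.pairing P P) ∧ (∃ ρ : ℤ, ∀ (ι : PadicAlgCl 2 ≃+* ℂ) (K : Type) [Field K] [NumberField K] [IsGalois ℚ K],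
    Literature.NumberTheory.EllipticCurves.IsImaginaryQuadratic K → ((Ideal.span {(2 : ℤ)}).primesOver
    (NumberField.RingOfIntegers K)).ncard = 2 → ∀ (𝔭 𝔭' : IsDedekindDomain.HeightOneSpectrum
    (NumberField.RingOfIntegers K)), ((2 : ℕ) : NumberField.RingOfIntegers K) ∈ 𝔭.asIdeal → ((2 : ℕ) :
    NumberField.RingOfIntegers K) ∈ 𝔭'.asIdeal → 𝔭 ≠ 𝔭' → ∀ (κ : DirichletCharacter ℂ (NumberField.discr
    K).natAbs), (∀ ℓ : ℕ, ℓ.Prime → ℓ ≠ 2 → κ ℓ = (jacobiSym (NumberField.discr K) ℓ : ℂ)) → ∀ (V V' :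
    WeierstrassCurve ℚ) [V.IsElliptic] [V.IsGloballyMinimal] [V'.IsElliptic] [V'.IsGloballyMinimal],
    Literature.NumberTheory.EllipticCurves.IsOrdinaryAt V 2 → ∀ {N N' : ℕ} [NeZero N] [NeZero N'] (f :
    CuspForm (CongruenceSubgroup.Gamma0 N) 2) (f' : CuspForm (CongruenceSubgroup.Gamma0 N') 2),
    Literature.NumberTheory.EllipticCurves.ModularForms.IsNewformOf V f →
    Literature.NumberTheory.EllipticCurves.ModularForms.IsNewformOf V' f' → (∀ n : ℕ,
    Literature.NumberTheory.EllipticCurves.ModularForms.cuspCoeff f' n = κ (n : ZMod _) *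
    Literature.NumberTheory.EllipticCurves.ModularForms.cuspCoeff f n) → ∀ {M M' : ℕ} [NeZero M] [NeZero
    M'] (g : CuspForm (CongruenceSubgroup.Gamma0 M) 2) (g' : CuspForm (CongruenceSubgroup.Gamma0 M') 2) (W
    W' : WeierstrassCurve ℚ) [W.IsElliptic] [W'.IsElliptic],
    Literature.NumberTheory.EllipticCurves.ModularForms.IsNewformOf W g →
    Literature.NumberTheory.EllipticCurves.ModularForms.IsNewformOf W' g' → (∀ m : ℕ,
    Literature.NumberTheory.EllipticCurves.ModularForms.cuspCoeff g m = (ZMod.χ₈'.ringHomComp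
    (Int.castRingHom ℂ)) m * Literature.NumberTheory.EllipticCurves.ModularForms.cuspCoeff f m) → (∀ m :
    ℕ, Literature.NumberTheory.EllipticCurves.ModularForms.cuspCoeff g' m = (ZMod.χ₈'.ringHomComp
    (Int.castRingHom ℂ)) m * Literature.NumberTheory.EllipticCurves.ModularForms.cuspCoeff f' m) →
    W.analyticRank = 1 → W'.entireLFunction 1 ≠ 0 → ∀ {H : Type} [Field H] [NumberField H] [Algebra K H]
    [(V.baseChange H).IsGloballyMinimal], Module.finrank K H = 2 → ∀ {t : H} (htK : t ∉ Set.range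
    (algebraMap K H)) (ht2 : t ^ 2 = algebraMap ℚ H (-2)) (htQ : t ∉ Set.range (algebraMap ℚ H)) (G :
    Subgroup (H ≃ₐ[ℚ] H)) (χ : G →* ℂˣ) (s : G → ℤ), (∀ σ, ((χ σ : ℂˣ) : ℂ) = (s σ : ℂ)) → (∀ (σ : G) (a :
    K), σ.1 (algebraMap K H a) = algebraMap K H a) → ∀ (τ : H ≃ₐ[ℚ] H) (hτG : τ ∈ G), s ⟨τ, hτG⟩ = -1 → (∀
    a : K, τ (algebraMap K H a) = algebraMap K H a) → τ t = -t → ∀ [(V.quadraticTwist (-2)).IsElliptic], ∃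
    DH : WeierstrassCurve.PAdicHeightDataK V 2 H, (∀ (σ : G) (a b : (V.baseChange H).toAffine.Point),
    DH.pairing (Literature.NumberTheory.EllipticCurves.pointGalHom V H σ.1 a)
    (Literature.NumberTheory.EllipticCurves.pointGalHom V H σ.1 b) = DH.pairing a b) ∧
    Literature.NumberTheory.EllipticCurves.Disegni2017.ChiLineGrossZagierClauses ι K V H f (ι
    (((Literature.NumberTheory.EllipticCurves.unitRoot V 2 : ℚ_[2]) : PadicAlgCl 2)))
    (Literature.NumberTheory.EllipticCurves.Disegni2017.baseChangeDirichlet K (ZMod.χ₈'.ringHomComp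
    (Int.castRingHom ℂ))) 𝔭 𝔭' G χ DH ∧ ∃ r : ℚ, r ≠ 0 ∧ padicValRat 2 r = ρ ∧ ∀ (Dc :
    WeierstrassCurve.PAdicHeightData (V.quadraticTwist (-2)) 2), Dc.IsCanonicalSqMinusTwist → ∀ P :
    (V.quadraticTwist (-2)).toAffine.Point, DH.pairing
    (Summit.BirchSwinnertonDyer.Rank1Residual.AdditivePotMult.twistPointEquivOver V (htQ) ht2
    (WeierstrassCurve.QuadraticDescent.incl H (V.quadraticTwist (-2)) P))
    (Summit.BirchSwinnertonDyer.Rank1Residual.AdditivePotMult.twistPointEquivOver V (htQ) ht2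
    (WeierstrassCurve.QuadraticDescent.incl H (V.quadraticTwist (-2)) P)) = (r : ℚ_[2]) * Dc.pairing P P) ) := by
  intro hB hE hPin hmod
  exact ⟨disegniGZ_line_of_prints hB hE hPin hmod (ZMod.χ₈.ringHomComp (Int.castRingHom ℂ))
      isPrimitive_χ₈_ringHomComp dvd_rfl ⟨4, rfl⟩ 2 2 (by norm_num) χ₈_ringHomComp_eq_jacobiSym,
    disegniGZ_line_of_prints hB hE hPin hmod (ZMod.χ₄.ringHomComp (Int.castRingHom ℂ))
      isPrimitive_χ₄_ringHomComp ⟨2, rfl⟩ ⟨2, rfl⟩ (-1) (-1) (by norm_num) χ₄_ringHomComp_eq_jacobiSym,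
    disegniGZ_line_of_prints hB hE hPin hmod (ZMod.χ₈'.ringHomComp (Int.castRingHom ℂ))
      isPrimitive_χ₈'_ringHomComp dvd_rfl ⟨4, rfl⟩ (-2) (-2) (by norm_num) χ₈'_ringHomComp_eq_jacobiSym⟩

end Pair

end Summit.BirchSwinnertonDyer.BirchSwinnertonDyer.Theorems.PrintCf2.DisegniPairTwo

end
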